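import Summits.QuantumFields.YangMills.Theorems.MirrorModularBoostsSoftKernelBoostCovarianceDiagCorePeel
import Summits.QuantumFields.YangMills.Theorems.MirrorModularBoostsSoftKernelBoostCovarianceDiagCloudGrowth
import Summits.QuantumFields.YangMills.Theorems.MirrorModularBoostsSoftKernelBoostCovarianceAsmConstantsAndBumps
import Summits.QuantumFields.YangMills.Theorems.CurvatureBoostCovariance.Negative.Unbundled
import Literature.MathematicalPhysics.QuantumFieldTheory.OSEuclideanRotationGenerator
import HarnessLib

/-!
# `SoftKernelBoostCovariance`, line `Sketch` v3.12: helpers for stub (G) `stub_diagGrowthT` (frame dictionary, transport, supports)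

Support file (helpers, part I) for crux stmt-QuantumFields-14999 (`MirrorModularBoosts.SoftKernelBoostCovariance`), registered
skeleton `Cruxes/SoftKernelBoostCovariance/Lines/Sketch.lean` v3.12.  Reading the `45°` multiple-reflection chain
`P⟨m, G⟩ = ⟨2+m, T_s(Θf̄ ⊗ (f ⊗ T_s G))⟩` of a box insertion `f` in the `e₀` frame of `S₁` (`R_θ = planeRot 0 θ`, `θ = ±π/4`):
`Θ ∘ R_θ⁻¹ = R_θ ∘ Θ` and the frame dictionary `T(ΘV* ⊗ V) = ⟪V∘R_θ, V∘R_θ⁻¹⟫_{S₁}`; planar rotations / reflections preserve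
Lebesgue measure on `ℝ × ℝ` (`measurePreserving_planarLin`, via `Real.map_matrix_volume_pi_eq_smul_volume_pi`); product forms, masses
and `e₀`-windows of the transported insertions `J₂ = f ∘ R_θ⁻¹`, `J₁ = (Θf̄) ∘ R_θ⁻¹`; transport `linActMulti R ∘ Pᴺ = P_Rᴺ ∘ linActMulti R`;
the support of the `45°` chain (`x⁰ − |x¹| ≥ min (s−c−2δ) (2ks − ℓ_W)` slotwise); `√2/2 ∈ [7/10, 3/4]`.  Registered helper package:
`stub_diagGrowthTHelpers`.  References: Glimm–Jaffe 1987 §10.5; Osterwalder–Schrader, CMP 31 (1973) §4.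
-/

noncomputable section

namespace Summit.QuantumFields.YangMills.Theorems.SoftKernelBoostCovariance.Sketch

open scoped BigOperators SchwartzMap InnerProductSpace ComplexConjugate
open MeasureTheory Filter Topology
open Literature.MathematicalPhysics.QuantumLattice Literature.MathematicalPhysics.AQFT
  Literature.MathematicalPhysics.QuantumFieldTheory
open Summit.QuantumFields.YangMills.Theorems.NPointIsotropy.Negative (E4 NPointRegular)
open Summit.QuantumFields.YangMills.Theorems.CurvatureSandwichBound.Negative (SandwichBound)

namespace DiagGrowthT

/-! ## Planar geometry of the frame `R_θ = planeRot 0 θ` -/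

/-- Coordinates of `R_θ x`. -/
theorem planeRot_coord (θ : ℝ) (x : E4) :
    planeRot (0 : Fin 3) θ x 0 = Real.cos θ * x 0 + Real.sin θ * x 1 ∧
    planeRot (0 : Fin 3) θ x 1 = -Real.sin θ * x 0 + Real.cos θ * x 1 ∧
    planeRot (0 : Fin 3) θ x 2 = x 2 ∧ planeRot (0 : Fin 3) θ x 3 = x 3 := by
  refine ⟨?_, ?_, ?_, ?_⟩ <;> simp [planeRot_apply]

/-- The translation vector `a = s·R_θ e₀` of the transported chain: `a⁰ = s cos θ`, `a¹ = -s sin θ`, `a² = a³ = 0`. -/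
theorem smul_planeRot_e0 (θ s : ℝ) :
    (planeRot (0 : Fin 3) θ (s • EuclideanSpace.single 0 1) : E4) 0 = s * Real.cos θ ∧
    (planeRot (0 : Fin 3) θ (s • EuclideanSpace.single 0 1) : E4) 1 = -(s * Real.sin θ) ∧
    (planeRot (0 : Fin 3) θ (s • EuclideanSpace.single 0 1) : E4) 2 = 0 ∧
    (planeRot (0 : Fin 3) θ (s • EuclideanSpace.single 0 1) : E4) 3 = 0 := by
  obtain ⟨h0, h1, h2, h3⟩ := planeRot_coord θ (s • EuclideanSpace.single 0 1)
  refine ⟨?_, ?_, ?_, ?_⟩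
  · rw [h0]; simp [mul_comm]
  · rw [h1]; simp [mul_comm]
  · rw [h2]; simp
  · rw [h3]; simp

/-- **`Θ ∘ R_θ⁻¹ = R_θ ∘ Θ`**: the time reflection conjugates a planar rotation to its inverse. -/
theorem timeReflection_planeRot_symm (θ : ℝ) (y : E4) :
    timeReflection 4 ((planeRot (0 : Fin 3) θ).symm y) = planeRot (0 : Fin 3) θ (timeReflection 4 y) := by
  obtain ⟨h0, h1, h2, h3⟩ := planeRot_symm_coord_asm θ y
  ext j
  fin_cases j <;> simp [timeReflection_apply, planeRot_apply, h0, h1, h2, h3]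
  ring

/-- **The `45°` adjoint read in the `e₀` frame**: `(ΘV*) ∘ R_θ⁻¹ = Θ(V ∘ R_θ)*`. -/
theorem linActMulti_osAdjoint (θ : ℝ) {d : ℕ} (V : 𝓢((Fin d → E4), ℂ)) :
    linActMulti (planeRot (0 : Fin 3) θ) (osAdjoint V) = osAdjoint (linActMulti (planeRot (0 : Fin 3) θ).symm V) := by
  ext x
  simp only [linActMulti_apply, osAdjoint_apply, LinearIsometryEquiv.symm_symm]
  congr 1
  congr 1
  funext i
  exact timeReflection_planeRot_symm θ _

/-- **Frame dictionary**: the diagonal pairing of the pull-back `T = 𝔖 ∘ (R_θ·)` is an `e₀` pairing of `S₁`,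
`T(ΘV* ⊗ V) = ⟪V ∘ R_θ, V ∘ R_θ⁻¹⟫_{S₁}`. -/
theorem frame_dictionary (S₁ : SchwingerFamily E4) (θ : ℝ) {d : ℕ} (V : 𝓢((Fin d → E4), ℂ)) :
    (fun n' => (S₁ n').comp (linActMulti (planeRot (0 : Fin 3) θ)) : SchwingerFamily E4) (d + d)
        ((osAdjoint V).appendTensor V) =
      S₁.osPairing (linActMulti (planeRot (0 : Fin 3) θ).symm V) (linActMulti (planeRot (0 : Fin 3) θ) V) := by
  show S₁ (d + d) (linActMulti (planeRot (0 : Fin 3) θ) ((osAdjoint V).appendTensor V)) = _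
  rw [linActMulti_appendTensor, linActMulti_osAdjoint]
  rfl

/-! ## Planar linear maps preserve Lebesgue measure when `|det| = 1` -/

/-- A planar linear map of `ℝ × ℝ` with `|det| = 1` preserves Lebesgue measure (matrix rescaling of `volume` on
`Fin 2 → ℝ`, transported along `finTwoArrow`). -/
theorem measurePreserving_planarLin (m₁₁ m₁₂ m₂₁ m₂₂ : ℝ) (hdet : |m₁₁ * m₂₂ - m₁₂ * m₂₁| = 1) :
    MeasurePreserving (fun p : ℝ × ℝ => (m₁₁ * p.1 + m₁₂ * p.2, m₂₁ * p.1 + m₂₂ * p.2)) := by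
  classical
  set M : Matrix (Fin 2) (Fin 2) ℝ := !![m₁₁, m₁₂; m₂₁, m₂₂] with hM
  have hdetM : M.det = m₁₁ * m₂₂ - m₁₂ * m₂₁ := by
    rw [hM, Matrix.det_fin_two_of]
  have hne : M.det ≠ 0 := by
    intro h0
    rw [hdetM] at h0
    rw [h0, abs_zero] at hdet
    exact zero_ne_one hdet
  have h1 : MeasurePreserving (Matrix.toLin' M) := by
    refine ⟨(Matrix.toLin' M).continuous_of_finiteDimensional.measurable, ?_⟩
    rw [Real.map_matrix_volume_pi_eq_smul_volume_pi hne, hdetM, abs_inv, hdet, inv_one, ENNReal.ofReal_one,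
      one_smul]
  have h2 := MeasureTheory.volume_preserving_finTwoArrow ℝ
  have h3 := (h2.comp h1).comp (h2.symm _)
  have hfun : (fun p : ℝ × ℝ => (m₁₁ * p.1 + m₁₂ * p.2, m₂₁ * p.1 + m₂₂ * p.2)) =
      (⇑(MeasurableEquiv.finTwoArrow (α := ℝ)) ∘ ⇑(Matrix.toLin' M)) ∘
        ⇑(MeasurableEquiv.finTwoArrow (α := ℝ)).symm := by
    funext p
    simp [hM, Matrix.toLin'_apply, Matrix.mulVec, dotProduct, Fin.sum_univ_two]
  rw [hfun]
  exact h3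

/-- Change of variables under a measure-preserving planar map: integrability and the `L¹` mass are unchanged. -/
theorem integrable_and_mass_comp {ρ : ℝ × ℝ → ℝ × ℝ} (hρ : MeasurePreserving ρ) {g : ℝ × ℝ → ℂ}
    (hg : Integrable g) : Integrable (fun p => g (ρ p)) ∧ (∫ p, ‖g (ρ p)‖) = ∫ p, ‖g p‖ := by
  refine ⟨hρ.integrable_comp_of_integrable hg, ?_⟩
  have h := integral_map hρ.measurable.aemeasurable (f := fun y => ‖g y‖)
    (by rw [hρ.map_eq]; exact hg.aestronglyMeasurable.norm)
  rw [hρ.map_eq] at h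
  exact h.symm

/-! ## The transported insertions `J₂ = f ∘ R_θ⁻¹`, `J₁ = (Θf̄) ∘ R_θ⁻¹`: product form, masses, windows -/

section Insertions

variable (θ : ℝ) {f : 𝓢((Fin 1 → E4), ℂ)} {g hh : ℝ × ℝ → ℂ}
  (hf : ∀ x, f x = g (x 0 0, x 0 1) * hh (x 0 2, x 0 3))

include hf in
/-- Product form of `J₂ = f ∘ R_θ⁻¹`: planar factor `g ∘ ρ₂`, `ρ₂ p = (cos θ p₁ − sin θ p₂, sin θ p₁ + cos θ p₂)`. -/
theorem productForm₂ (x : Fin 1 → E4) :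
    linActMulti (planeRot (0 : Fin 3) θ) f x =
      g (Real.cos θ * x 0 0 - Real.sin θ * x 0 1, Real.sin θ * x 0 0 + Real.cos θ * x 0 1) * hh (x 0 2, x 0 3) := by
  obtain ⟨h0, h1, h2, h3⟩ := planeRot_symm_coord_asm θ (x 0)
  rw [linActMulti_apply, hf]
  simp only [h0, h1, h2, h3]

include hf in
/-- Product form of `J₁ = (Θf̄) ∘ R_θ⁻¹`: planar factor `conj ∘ g ∘ ρ₁`, `ρ₁ p = (−(cos θ p₁ − sin θ p₂), sin θ p₁ + cos θ p₂)`,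
transverse factor `conj ∘ hh`. -/
theorem productForm₁ (x : Fin 1 → E4) :
    linActMulti (planeRot (0 : Fin 3) θ) (osAdjoint f) x =
      conj (g (-(Real.cos θ * x 0 0 - Real.sin θ * x 0 1), Real.sin θ * x 0 0 + Real.cos θ * x 0 1)) *
        conj (hh (x 0 2, x 0 3)) := by
  obtain ⟨h0, h1, h2, h3⟩ := planeRot_symm_coord_asm θ (x 0)
  have hr : (Fin.rev (0 : Fin 1)) = 0 := Subsingleton.elim _ _
  rw [linActMulti_apply, osAdjoint_apply, hf, map_mul, hr]
  simp only [timeReflection_apply, if_true, show (1 : Fin 4) ≠ 0 by decide, show (2 : Fin 4) ≠ 0 by decide,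
    show (3 : Fin 4) ≠ 0 by decide, if_false, h0, h1, h2, h3]

/-- `ρ₂` preserves Lebesgue measure. -/
theorem measurePreserving_ρ₂ :
    MeasurePreserving (fun p : ℝ × ℝ => (Real.cos θ * p.1 - Real.sin θ * p.2, Real.sin θ * p.1 + Real.cos θ * p.2)) := by
  have h := measurePreserving_planarLin (Real.cos θ) (-Real.sin θ) (Real.sin θ) (Real.cos θ)
    (by rw [show Real.cos θ * Real.cos θ - -Real.sin θ * Real.sin θ = 1 by nlinarith [Real.cos_sq_add_sin_sq θ]]; simp)
  convert h using 2
  ring_nf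

/-- `ρ₁` preserves Lebesgue measure. -/
theorem measurePreserving_ρ₁ :
    MeasurePreserving
      (fun p : ℝ × ℝ => (-(Real.cos θ * p.1 - Real.sin θ * p.2), Real.sin θ * p.1 + Real.cos θ * p.2)) := by
  have h := measurePreserving_planarLin (-Real.cos θ) (Real.sin θ) (Real.sin θ) (Real.cos θ)
    (by rw [show -Real.cos θ * Real.cos θ - Real.sin θ * Real.sin θ = -1 by nlinarith [Real.cos_sq_add_sin_sq θ]]; simp)
  convert h using 2
  ring_nf

variable {kk : ℝ} (hcos : Real.cos θ = kk) (hsin : |Real.sin θ| = kk) (hk : 0 < kk)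
  {c δ : ℝ} (hg : ∀ p, g p ≠ 0 → (c ≤ p.1 ∧ p.1 ≤ c + δ) ∧ |p.2| ≤ δ)

include hcos hsin hk hg in
/-- **Window of `J₂`**: its planar factor is supported at times `p₁ ∈ [k(c−δ), k(c+2δ)]`, so after the shift by
`a⁰ = s k` in `[k(s+c−δ), k(s+c−δ) + 3kδ]`. -/
theorem window₂ (s : ℝ) (p : ℝ × ℝ)
    (hp : g (Real.cos θ * p.1 - Real.sin θ * p.2, Real.sin θ * p.1 + Real.cos θ * p.2) ≠ 0) :
    kk * (s + c - δ) ≤ p.1 + s * kk ∧ p.1 + s * kk ≤ kk * (s + c - δ) + 3 * (kk * δ) := by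
  obtain ⟨⟨h1, h2⟩, h3⟩ := hg _ hp
  set q₁ := Real.cos θ * p.1 - Real.sin θ * p.2 with hq₁
  set q₂ := Real.sin θ * p.1 + Real.cos θ * p.2 with hq₂
  have hid : p.1 = Real.cos θ * q₁ + Real.sin θ * q₂ := by
    rw [hq₁, hq₂]; linear_combination (-p.1) * Real.cos_sq_add_sin_sq θ
  have hb : |Real.sin θ * q₂| ≤ kk * δ := by
    rw [abs_mul, hsin]; exact mul_le_mul_of_nonneg_left h3 hk.le
  have hb1 := neg_abs_le (Real.sin θ * q₂)
  have hb2 := le_abs_self (Real.sin θ * q₂)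
  rw [hcos] at hid
  constructor <;> nlinarith [mul_le_mul_of_nonneg_left h1 hk.le, mul_le_mul_of_nonneg_left h2 hk.le]

include hcos hsin hk hg in
/-- **Window of `J₁`**: its planar factor is supported at times `p₁ ∈ [−k(c+2δ), k(δ−c)]`, so after the shift by
`a⁰ = s k` in `[k(s−c−2δ), k(s−c−2δ) + 3kδ]`. -/
theorem window₁ (s : ℝ) (p : ℝ × ℝ)
    (hp : conj (g (-(Real.cos θ * p.1 - Real.sin θ * p.2), Real.sin θ * p.1 + Real.cos θ * p.2)) ≠ 0) :
    kk * (s - c - 2 * δ) ≤ p.1 + s * kk ∧ p.1 + s * kk ≤ kk * (s - c - 2 * δ) + 3 * (kk * δ) := by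
  have hp' : g (-(Real.cos θ * p.1 - Real.sin θ * p.2), Real.sin θ * p.1 + Real.cos θ * p.2) ≠ 0 :=
    fun h0 => hp (by rw [h0, map_zero])
  obtain ⟨⟨h1, h2⟩, h3⟩ := hg _ hp'
  set q₁ := -(Real.cos θ * p.1 - Real.sin θ * p.2) with hq₁
  set q₂ := Real.sin θ * p.1 + Real.cos θ * p.2 with hq₂
  have hid : p.1 = -(Real.cos θ * q₁) + Real.sin θ * q₂ := by
    rw [hq₁, hq₂]; linear_combination (-p.1) * Real.cos_sq_add_sin_sq θ
  have hb : |Real.sin θ * q₂| ≤ kk * δ := by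
    rw [abs_mul, hsin]; exact mul_le_mul_of_nonneg_left h3 hk.le
  have hb1 := neg_abs_le (Real.sin θ * q₂)
  have hb2 := le_abs_self (Real.sin θ * q₂)
  rw [hcos] at hid
  constructor <;> nlinarith [mul_le_mul_of_nonneg_left h1 hk.le, mul_le_mul_of_nonneg_left h2 hk.le]

end Insertions

/-- **Support of a windowed product-form translate** (closed strip). -/
theorem tsupport_translate_window {J : 𝓢((Fin 1 → E4), ℂ)} {gJ hJ : ℝ × ℝ → ℂ}
    (hJf : ∀ x, J x = gJ (x 0 0, x 0 1) * hJ (x 0 2, x 0 3)) (a : E4) (ha2 : a 2 = 0) (ha3 : a 3 = 0)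
    {α ℓ : ℝ} (hw : ∀ p, gJ p ≠ 0 → α ≤ p.1 + a 0 ∧ p.1 + a 0 ≤ α + ℓ) :
    tsupport ((translateMulti a J : 𝓢((Fin 1 → E4), ℂ)) : (Fin 1 → E4) → ℂ) ⊆ {x | α ≤ x 0 0 ∧ x 0 0 ≤ α + ℓ} := by
  refine closure_minimal (fun x hx => ?_) ?_
  · rw [Function.mem_support, DiagPeel.translate_productForm hJf a rfl rfl ha2 ha3] at hx
    have h := hw _ (left_ne_zero_of_mul hx)
    simp only [sub_add_cancel] at h
    exact h
  · have hc : Continuous fun x : Fin 1 → E4 => x 0 0 :=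
      (EuclideanSpace.proj (0 : Fin 4)).continuous.comp (continuous_apply 0)
    exact (isClosed_le continuous_const hc).inter (isClosed_le hc continuous_const)

/-! ## Transport of the chain to the `e₀` frame and the support of the `45°` chain -/

/-- **Transport**: `linActMulti L ∘ Pᴺ = P_Lᴺ ∘ linActMulti L` for the chain `P⟨m,G⟩ = ⟨2+m, T_s(Θf̄ ⊗ (f ⊗ T_s G))⟩` and its
transported version `P_L⟨m,G⟩ = ⟨2+m, τ_{L(se₀)}((Θf̄)∘L⁻¹ ⊗ (f∘L⁻¹ ⊗ τ_{L(se₀)} G))⟩` (as points of `Σ m, 𝓢((ℝ⁴)^m)`). -/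
theorem transport (L : E4 ≃ₗᵢ[ℝ] E4) (s : ℝ) (f : 𝓢((Fin 1 → E4), ℂ))
    (P Q : (Σ m : ℕ, 𝓢((Fin m → E4), ℂ)) → (Σ m : ℕ, 𝓢((Fin m → E4), ℂ)))
    (hP : P = fun Gσ => ⟨1 + (1 + Gσ.1), translateMulti (s • EuclideanSpace.single 0 1)
      ((osAdjoint f).appendTensor (f.appendTensor (translateMulti (s • EuclideanSpace.single 0 1) Gσ.2)))⟩)
    (hQ : Q = fun Gσ => ⟨1 + (1 + Gσ.1), translateMulti (L (s • EuclideanSpace.single 0 1))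
      ((linActMulti L (osAdjoint f)).appendTensor
        ((linActMulti L f).appendTensor (translateMulti (L (s • EuclideanSpace.single 0 1)) Gσ.2)))⟩)
    (N : ℕ) (G : Σ m : ℕ, 𝓢((Fin m → E4), ℂ)) :
    (⟨(P^[N] G).1, linActMulti L (P^[N] G).2⟩ : Σ m : ℕ, 𝓢((Fin m → E4), ℂ)) = Q^[N] ⟨G.1, linActMulti L G.2⟩ := by
  have hstep : ∀ G : Σ m : ℕ, 𝓢((Fin m → E4), ℂ),
      (⟨(P G).1, linActMulti L (P G).2⟩ : Σ m : ℕ, 𝓢((Fin m → E4), ℂ)) = Q ⟨G.1, linActMulti L G.2⟩ := by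
    intro G
    subst hP hQ
    change (⟨1 + (1 + G.1), linActMulti L (translateMulti (s • EuclideanSpace.single 0 1)
        ((osAdjoint f).appendTensor (f.appendTensor (translateMulti (s • EuclideanSpace.single 0 1) G.2))))⟩ :
        Σ m : ℕ, 𝓢((Fin m → E4), ℂ)) =
      ⟨1 + (1 + G.1), translateMulti (L (s • EuclideanSpace.single 0 1))
        ((linActMulti L (osAdjoint f)).appendTensor
          ((linActMulti L f).appendTensor (translateMulti (L (s • EuclideanSpace.single 0 1)) (linActMulti L G.2))))⟩
    have h1 : linActMulti L (translateMulti (s • EuclideanSpace.single 0 1)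
        ((osAdjoint f).appendTensor (f.appendTensor (translateMulti (s • EuclideanSpace.single 0 1) G.2)))) =
        translateMulti (L (s • EuclideanSpace.single 0 1))
          ((linActMulti L (osAdjoint f)).appendTensor
            ((linActMulti L f).appendTensor (translateMulti (L (s • EuclideanSpace.single 0 1)) (linActMulti L G.2)))) := by
      rw [linActMulti_translateMulti, linActMulti_appendTensor, linActMulti_appendTensor, linActMulti_translateMulti]
    rw [h1]
  induction N generalizing G with
  | zero => rfl
  | succ N ih =>
    rw [Function.iterate_succ_apply, Function.iterate_succ_apply, ih (P G), hstep G]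

/-- Closed box support of the windowed insertion `f` itself. -/
theorem tsupport_f_subset {f : 𝓢((Fin 1 → E4), ℂ)} {g hh : ℝ × ℝ → ℂ}
    (hf : ∀ x, f x = g (x 0 0, x 0 1) * hh (x 0 2, x 0 3)) {c δ : ℝ}
    (hg : ∀ p, g p ≠ 0 → (c ≤ p.1 ∧ p.1 ≤ c + δ) ∧ |p.2| ≤ δ) :
    tsupport (f : (Fin 1 → E4) → ℂ) ⊆ {z | (c ≤ z 0 0 ∧ z 0 0 ≤ c + δ) ∧ |z 0 1| ≤ δ} := by
  refine closure_minimal (fun z hz => ?_) ?_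
  · rw [Function.mem_support, hf] at hz
    exact hg _ (left_ne_zero_of_mul hz)
  · have hc0 : Continuous fun x : Fin 1 → E4 => x 0 0 :=
      (EuclideanSpace.proj (0 : Fin 4)).continuous.comp (continuous_apply 0)
    have hc1 : Continuous fun x : Fin 1 → E4 => x 0 1 :=
      (EuclideanSpace.proj (1 : Fin 4)).continuous.comp (continuous_apply 0)
    exact ((isClosed_le continuous_const hc0).inter (isClosed_le hc0 continuous_const)).inter
      (isClosed_le (continuous_abs.comp hc1) continuous_const)

/-- Closed box support of `Θf̄`. -/
theorem tsupport_osAdjoint_f_subset {f : 𝓢((Fin 1 → E4), ℂ)} {g hh : ℝ × ℝ → ℂ}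
    (hf : ∀ x, f x = g (x 0 0, x 0 1) * hh (x 0 2, x 0 3)) {c δ : ℝ}
    (hg : ∀ p, g p ≠ 0 → (c ≤ p.1 ∧ p.1 ≤ c + δ) ∧ |p.2| ≤ δ) :
    tsupport ((osAdjoint f : 𝓢((Fin 1 → E4), ℂ)) : (Fin 1 → E4) → ℂ) ⊆
      {z | (c ≤ -z 0 0 ∧ -z 0 0 ≤ c + δ) ∧ |z 0 1| ≤ δ} := by
  refine closure_minimal (fun z hz => ?_) ?_
  · rw [Function.mem_support, osAdjoint_apply, map_ne_zero, hf] at hz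
    have h := hg _ (left_ne_zero_of_mul hz)
    simpa [timeReflection_apply] using h
  · have hc0 : Continuous fun x : Fin 1 → E4 => x 0 0 :=
      (EuclideanSpace.proj (0 : Fin 4)).continuous.comp (continuous_apply 0)
    have hc1 : Continuous fun x : Fin 1 → E4 => x 0 1 :=
      (EuclideanSpace.proj (1 : Fin 4)).continuous.comp (continuous_apply 0)
    exact ((isClosed_le continuous_const hc0.neg).inter (isClosed_le hc0.neg continuous_const)).inter
      (isClosed_le (continuous_abs.comp hc1) continuous_const)

/-- **Support of the `45°` chain `PᵏW`** (in its own frame): every slot `x` of every point of the support satisfies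
`x⁰ − |x¹| ≥ min (s − c − 2δ) (2ks − ℓ_W)` — the insertions by their boxes, the cloud because it has been pushed up by
`2ks` while its sideways extent is `≤ ℓ_W`. -/
theorem tsupport_chain {f : 𝓢((Fin 1 → E4), ℂ)} {g hh : ℝ × ℝ → ℂ}
    (hf : ∀ x, f x = g (x 0 0, x 0 1) * hh (x 0 2, x 0 3)) {c δ : ℝ} (hc : 0 ≤ c) (hδ : 0 ≤ δ)
    (hg : ∀ p, g p ≠ 0 → (c ≤ p.1 ∧ p.1 ≤ c + δ) ∧ |p.2| ≤ δ)
    {n : ℕ} (W : 𝓢((Fin n → E4), ℂ)) {ℓW : ℝ}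
    (hWt : tsupport (W : (Fin n → E4) → ℂ) ⊆ {x | ∀ i, 0 ≤ x i 0 ∧ |x i 1| ≤ ℓW}) {s : ℝ} (hs : 0 ≤ s)
    (P : (Σ m : ℕ, 𝓢((Fin m → E4), ℂ)) → (Σ m : ℕ, 𝓢((Fin m → E4), ℂ)))
    (hP : P = fun Gσ => ⟨1 + (1 + Gσ.1), translateMulti (s • EuclideanSpace.single 0 1)
      ((osAdjoint f).appendTensor (f.appendTensor (translateMulti (s • EuclideanSpace.single 0 1) Gσ.2)))⟩)
    (k : ℕ) :
    tsupport ((P^[k] ⟨n, W⟩).2 : (Fin (P^[k] ⟨n, W⟩).1 → E4) → ℂ) ⊆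
      {x | ∀ i, min (s - c - 2 * δ) (2 * k * s - ℓW) ≤ x i 0 - |x i 1|} := by
  subst hP
  induction k with
  | zero =>
    intro x hx i
    obtain ⟨h0, h1⟩ := hWt hx i
    show min (s - c - 2 * δ) (2 * ((0 : ℕ) : ℝ) * s - ℓW) ≤ x i 0 - |x i 1|
    refine (min_le_right _ _).trans ?_
    push_cast
    linarith
  | succ k ih =>
    rw [Function.iterate_succ_apply']
    intro y hy i
    dsimp only at hy
    have hy' := OSReconstructionNoE1.tsupport_translateMulti_subset _ _ hy
    obtain ⟨hA, hBC⟩ := OSReconstructionNoE1.tsupport_appendTensor_subset _ _ hy'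
    obtain ⟨hB, hC⟩ := OSReconstructionNoE1.tsupport_appendTensor_subset _ _ hBC
    have hC' := OSReconstructionNoE1.tsupport_translateMulti_subset _ _ hC
    have e0 : (s • EuclideanSpace.single 0 1 : E4) 0 = s := by simp
    have e1 : (s • EuclideanSpace.single 0 1 : E4) 1 = 0 := by simp
    show min (s - c - 2 * δ) (2 * ((k + 1 : ℕ) : ℝ) * s - ℓW) ≤ y i 0 - |y i 1|
    push_cast
    induction i using Fin.addCases with
    | left i0 =>
      obtain ⟨⟨h1, h2⟩, h3⟩ := tsupport_osAdjoint_f_subset hf hg hA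
      rw [Subsingleton.elim i0 0]
      simp only [PiLp.sub_apply, e0, e1, sub_zero] at h1 h2 h3
      refine (min_le_left _ _).trans ?_
      have := neg_abs_le (y (Fin.castAdd _ 0) 1)
      linarith [le_abs_self (y (Fin.castAdd _ (0 : Fin 1)) 1)]
    | right j =>
      induction j using Fin.addCases with
      | left j0 =>
        obtain ⟨⟨h1, h2⟩, h3⟩ := tsupport_f_subset hf hg hB
        rw [Subsingleton.elim j0 0]
        simp only [PiLp.sub_apply, e0, e1, sub_zero] at h1 h2 h3
        refine (min_le_left _ _).trans ?_
        linarith [le_abs_self (y (Fin.natAdd 1 (Fin.castAdd _ (0 : Fin 1))) 1)]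
      | right j =>
        have h := ih hC' j
        simp only [PiLp.sub_apply, e0, e1, sub_zero] at h
        rcases le_total (s - c - 2 * δ) (2 * (k : ℝ) * s - ℓW) with hle | hle
        · rw [min_eq_left hle] at h
          refine (min_le_left _ _).trans ?_
          linarith
        · rw [min_eq_right hle] at h
          refine (min_le_right _ _).trans ?_
          linarith

/-! ## Reserve arithmetic: `k = √2/2 ∈ [7/10, 3/4]`, the reserve sums of (C) are `≤ 2·3^μ(u^{-μ}+v^{-μ})` -/

/-- `7/10 ≤ √2/2 ≤ 3/4`. -/
theorem sqrt_two_div_two_bounds : (7 : ℝ) / 10 ≤ Real.sqrt 2 / 2 ∧ Real.sqrt 2 / 2 ≤ 3 / 4 := by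
  constructor
  · have h : (7 : ℝ) / 5 ≤ Real.sqrt 2 := by
      rw [Real.le_sqrt' (by norm_num)]
      norm_num
    linarith
  · have h : Real.sqrt 2 ≤ 3 / 2 := by
      rw [Real.sqrt_le_left (by norm_num)]
      norm_num
    linarith

end DiagGrowthT

/-- **Registered helper package `stub_diagGrowthTHelpers` of stub (G) `stub_diagGrowthT`** (line `Sketch` v3.12): the `45°` adjoint
read in the `e₀` frame, `(ΘV*) ∘ R_θ⁻¹ = Θ(V ∘ R_θ)*`, and the frame dictionary `T(ΘV* ⊗ V) = ⟪V ∘ R_θ, V ∘ R_θ⁻¹⟫_{S₁}` for the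
pull-back `T = 𝔖 ∘ (R_θ ·)` — the conjunction of `DiagGrowthT.linActMulti_osAdjoint` and `DiagGrowthT.frame_dictionary`. [folklore] -/
theorem stub_diagGrowthTHelpers :
    open Literature.MathematicalPhysics.QuantumLattice Literature.MathematicalPhysics.AQFT
      Literature.MathematicalPhysics.QuantumFieldTheory
      Summit.QuantumFields.YangMills.Theorems.NPointIsotropy.Negative in
    ∀ (S₁ : SchwingerFamily E4) (θ : ℝ) (d : ℕ) (V : SchwartzMap (Fin d → E4) ℂ),
      linActMulti (planeRot (0 : Fin 3) θ) (osAdjoint V) = osAdjoint (linActMulti (planeRot (0 : Fin 3) θ).symm V) ∧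
      (fun n' => (S₁ n').comp (linActMulti (planeRot (0 : Fin 3) θ)) : SchwingerFamily E4) (d + d)
          ((osAdjoint V).appendTensor V) =
        S₁.osPairing (linActMulti (planeRot (0 : Fin 3) θ).symm V) (linActMulti (planeRot (0 : Fin 3) θ) V) :=
  fun S₁ θ _ V => ⟨DiagGrowthT.linActMulti_osAdjoint θ V, DiagGrowthT.frame_dictionary S₁ θ V⟩

end Summit.QuantumFields.YangMills.Theorems.SoftKernelBoostCovariance.Sketch

end
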